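import Mathlib
import Literature.AlgebraicGeometry.Resolution.MuPTorsorLocalUniformizationRelative
import Summits.ResolutionOfSingularities.ResolutionOfSingularities.Theorems.SoloInformedTorsorExits
import HarnessLib

/-!
# Local uniformization ascends along residue-growing `p`-layers (soloist, informed arm, s5)

Sorry-free. Let `k ⊆ K₀ ⊆ K` be fields of characteristic `p`, `O` a valuation ring of `K`
(ANY rank, any `k`), and `ξ ∈ K` with `ξ ^ p ∈ K₀` whose residue is NEW: `v(ξ - c) = 0` for every
`c ∈ O ∩ K₀` (so `ξ ∈ O`, `ξ ∉ K₀`, and `K₀ ⊂ K₁ := K₀(ξ)` is purely inseparable of degree `p`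
with residue extension of degree `p`: ramification index and defect are `1`).

**Theorem F** (`relLocalUniformization_adjoin_of_newResidue`). Relative local uniformization of
`O ∩ K₀` over `k` implies relative local uniformization of `O ∩ K₀(ξ)` over `k`.

Proof. Given a finitely generated `S ⊆ O ∩ K₁`, uniformize DOWNSTAIRS the algebra generated by an
affine model of `K₀`, the `p`-th powers of the generators of `S` (they lie in `K₀`:
`pow_mem_of_mem_adjoin_insert`) and `u := ξ ^ p`: a finitely generated `A₀ ⊆ O ∩ K₀`, regular at
the centre, `T := (A₀)_𝔪`. Then `u ∈ T^×` and `ū ∉ κ(T)^p` (a `p`-th root of `ū` in `κ(T) ⊆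
κ(O ∩ K₀)` would be the residue of `ξ`), so by LEMMA U of `SoloInformedTorsorExits`
(`exists_model_of_residuallyInseparablePresentation` with `q = 0`, `m = 1`) `T[ξ] ≅ T[Z]/(Z^p - u)`
is a regular local ring dominated by `O`, realised by a finitely generated `A₁ ∋ ξ`. Every
generator `r` of `S` has `r ^ p ∈ A₀ ⊆ A₁` and `r ∈ K₁ = Frac A₁`, hence lies in the NORMAL local
ring `T[ξ]` (`exists_model_adjoin_of_mem_adjoin`, Matsumura 19.4): adjoining the generators does
not change the local ring. ∎

So, granted local uniformization below, the `μ_p`-torsor problem of Temkin's Remark 1.3.5 (ii)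
(`RelMuPTorsorStepsAt`) is concentrated on the layers `K₀ ⊂ K₀(a)` WITHOUT residue growth
(ramification index `p`, or defect `p`). Over a perfect ground field and a residually algebraic
`O` every layer is of that kind (the residue fields are perfect); residue growth occurs over the
imperfect constant fields produced by the residually-algebraic reduction and in the class
"constants not separating" of `SoloInformedSeparatingConstants`.
-/

namespace Summit.ResolutionOfSingularities.ResolutionOfSingularities.Theorems

open IsLocalRing
open Literature.AlgebraicGeometry.Resolution

noncomputable section

variable {k K : Type} [Field k] [Field K] [Algebra k K]

/-- `K₀(ξ)^p ⊆ K₀` when `ξ^p ∈ K₀` (characteristic `p`): the elements with `p`-th power in `K₀`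
form an intermediate field (the preimage of `K₀` under Frobenius) containing `K₀` and `ξ`.
[folklore] -/
theorem pow_mem_of_mem_adjoin_insert {p : ℕ} [hp : Fact p.Prime] [CharP K p]
    (K₀ : IntermediateField k K) {ξ : K} (hξp : ξ ^ p ∈ K₀) {x : K}
    (hx : x ∈ IntermediateField.adjoin k (insert ξ (K₀ : Set K))) : x ^ p ∈ K₀ := by
  haveI : ExpChar K p := ExpChar.prime hp.out
  let F' : IntermediateField k K :=
    (K₀.toSubfield.comap (frobenius K p)).toIntermediateField fun c => by
      show frobenius K p (algebraMap k K c) ∈ K₀.toSubfield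
      rw [frobenius_def, ← map_pow]
      exact K₀.algebraMap_mem _
  have hF' : ∀ y : K, y ∈ F' ↔ y ^ p ∈ K₀ := fun y => by
    show frobenius K p y ∈ K₀.toSubfield ↔ _
    rw [frobenius_def]
    rfl
  have hle : IntermediateField.adjoin k (insert ξ (K₀ : Set K)) ≤ F' :=
    IntermediateField.adjoin_le_iff.mpr
      (Set.insert_subset ((hF' ξ).mpr hξp) fun y hy => (hF' y).mpr (pow_mem hy p))
  exact (hF' x).mp (hle hx)

/-- **Going down with regularity.** A finitely generated `A ⊆ O` contained in the subfield
`K' ⊆ K` and regular at the centre of `O` is, read in `K'`, regular at the centre of `O ∩ K'`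
(the two local rings are isomorphic; converse of `map_model`). [folklore] -/
theorem comap_model_regular (K' : IntermediateField k K) (O : ValuationSubring K)
    (A : Subalgebra k K) (hA : A.toSubring ≤ O.toSubring) (hAK : (A : Set K) ⊆ K')
    (hreg : IsRegularLocalRing (Localization.AtPrime
      (Ideal.comap (Subring.inclusion hA) (maximalIdeal O)))) :
    ∃ h₀ : (A.comap K'.val).toSubring ≤ (O.comap (algebraMap K' K)).toSubring,
      IsRegularLocalRing (Localization.AtPrime
        (Ideal.comap (Subring.inclusion h₀) (maximalIdeal (O.comap (algebraMap K' K))))) := by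
  classical
  have hfinj : Function.Injective K'.val := (K'.val : K' →+* K).injective
  have hAK' : ∀ x ∈ A, x ∈ Set.range K'.val := fun x hx => ⟨⟨x, hAK hx⟩, rfl⟩
  set A₀ : Subalgebra k K' := A.comap K'.val with hA₀
  have h₀ : A₀.toSubring ≤ (O.comap (algebraMap K' K)).toSubring := fun x hx => hA hx
  refine ⟨h₀, ?_⟩
  have hmapS : A₀.toSubring.map (K'.val : K' →+* K) = A.toSubring := by
    ext z
    simp only [Subring.mem_map, Subalgebra.mem_toSubring]
    constructor
    · rintro ⟨x, hx, rfl⟩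
      exact hx
    · intro hz
      obtain ⟨x, rfl⟩ := hAK' z hz
      exact ⟨x, hz, rfl⟩
  let e : A₀.toSubring ≃+* A.toSubring :=
    (A₀.toSubring.equivMapOfInjective (K'.val : K' →+* K) hfinj).trans
      (RingEquiv.subringCongr hmapS)
  have he : ∀ a : A₀.toSubring, ((e a : A.toSubring) : K) = K'.val a := fun a => rfl
  set P : Ideal A.toSubring := Ideal.comap (Subring.inclusion hA) (maximalIdeal O) with hP
  haveI hPp : P.IsPrime := Ideal.comap_isPrime _ _
  have hPe : P.comap (e : A₀.toSubring →+* A.toSubring) =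
      Ideal.comap (Subring.inclusion h₀) (maximalIdeal (O.comap (algebraMap K' K))) := by
    ext a
    have h2 : Subring.inclusion hA (e a) = ⟨K'.val a, hA (e a).2⟩ := Subtype.ext (he a)
    simp only [Ideal.mem_comap, hP, RingHom.coe_coe]
    rw [h2]
    exact (mk_mem_maximalIdeal_comap_iff O (algebraMap K' K) (h₀ a.2)).symm
  haveI : (P.comap (e : A₀.toSubring →+* A.toSubring)).IsPrime := Ideal.comap_isPrime _ _
  exact isRegularLocalRing_localization_atPrime_congr hPe
    ((isRegularLocalRing_localization_iff_of_ringEquiv e P).mp hreg)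

/-- **Theorem F, model form.** Under relative local uniformization of `O ∩ K₀`, a NEW residue
`p`-th root `ξ` (`ξ^p ∈ K₀`, `v(ξ - c) = 0` for all `c ∈ O ∩ K₀`): every finitely generated
`S ⊆ O ∩ K₀(ξ)` is dominated by a finitely generated `A ⊆ O ∩ K₀(ξ)` regular at the centre of
`O`. [this file] -/
theorem exists_model_of_newResidue {p : ℕ} [hp : Fact p.Prime] [CharP K p]
    (O : ValuationSubring K) (hk : ∀ c : k, algebraMap k K c ∈ O)
    (K₀ : IntermediateField k K) (hK₀ : K₀.FG) {ξ : K} (hξp : ξ ^ p ∈ K₀)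
    (hres : ∀ c ∈ K₀, c ∈ O → O.valuation (ξ - c) = 1)
    (hLU : RelLocalUniformization k K₀ (O.comap (algebraMap K₀ K)))
    (S : Subalgebra k K) (hSfg : S.FG) (hSO : S.toSubring ≤ O.toSubring)
    (hSK : (S : Set K) ⊆ IntermediateField.adjoin k (insert ξ (K₀ : Set K))) :
    ∃ (A : Subalgebra k K) (h : A.toSubring ≤ O.toSubring), S ≤ A ∧ A.FG ∧
      (A : Set K) ⊆ IntermediateField.adjoin k (insert ξ (K₀ : Set K)) ∧
      IsRegularLocalRing
        (Localization.AtPrime (Ideal.comap (Subring.inclusion h) (maximalIdeal O))) := by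
  classical
  set K₁ : IntermediateField k K := IntermediateField.adjoin k (insert ξ (K₀ : Set K)) with hK₁
  have hξO : ξ ∈ O := by
    have h := hres 0 K₀.zero_mem O.zero_mem
    rw [sub_zero] at h
    exact (O.valuation_le_one_iff ξ).mp h.le
  -- an affine model `B` of `K₀` inside `O`
  have hk₀ : ∀ c : k, algebraMap k K₀ c ∈ O.comap (algebraMap K₀ K) := fun c => by
    rw [ValuationSubring.mem_comap, ← IsScalarTower.algebraMap_apply]
    exact hk c
  obtain ⟨B, hBO, ⟨sB, hsB⟩, hBfr⟩ :=
    exists_affineModel k K₀ (intermediateField_fg_top_of_fg K₀ hK₀) (O.comap (algebraMap K₀ K))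
      hk₀
  obtain ⟨t, ht⟩ := hSfg
  have htS : ∀ x ∈ t, x ∈ S := fun x hx => by
    rw [← ht]
    exact Algebra.subset_adjoin hx
  have hsBB : ∀ b ∈ sB, b ∈ B := fun b hb => by
    rw [← hsB]
    exact Algebra.subset_adjoin hb
  -- generators downstairs: the model `B`, the `p`-th powers of `t`, and `u = ξ ^ p`
  set G : Finset K :=
    insert (ξ ^ p) (sB.image (fun b : K₀ => (b : K)) ∪ t.image fun x => x ^ p) with hG
  have hGmem : ∀ x : K, x ∈ G ↔
      x = ξ ^ p ∨ (∃ b ∈ sB, (b : K) = x) ∨ ∃ y ∈ t, y ^ p = x := fun x => by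
    rw [hG, Finset.mem_insert, Finset.mem_union, Finset.mem_image, Finset.mem_image]
  set S' : Subalgebra k K := Algebra.adjoin k (G : Set K) with hS'
  have hGK₀ : (G : Set K) ⊆ K₀ := by
    intro x hx
    rcases (hGmem x).mp (Finset.mem_coe.mp hx) with rfl | ⟨b, -, rfl⟩ | ⟨y, hy, rfl⟩
    · exact hξp
    · exact b.2
    · exact pow_mem_of_mem_adjoin_insert K₀ hξp (hSK (htS y hy))
  have hGO : (G : Set K) ⊆ O := by
    intro x hx
    rcases (hGmem x).mp (Finset.mem_coe.mp hx) with rfl | ⟨b, hb, rfl⟩ | ⟨y, hy, rfl⟩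
    · exact pow_mem hξO p
    · exact hBO (hsBB b hb)
    · exact pow_mem (hSO (htS y hy)) p
  have hS'O : S'.toSubring ≤ O.toSubring :=
    adjoin_toSubring_le_of_subset_valuationSubring O hk hGO
  have hS'K₀ : (S' : Set K) ⊆ K₀ := by
    intro x hx
    exact (Algebra.adjoin_le (S := K₀.toSubalgebra) hGK₀ : S' ≤ K₀.toSubalgebra) hx
  have hBS' : ∀ b : K₀, b ∈ B → (b : K) ∈ S' := by
    intro b hb
    have hb' : b ∈ Algebra.adjoin k (sB : Set K₀) := by rwa [hsB]
    have hmap : (Algebra.adjoin k (sB : Set K₀)).map K₀.val ≤ S' := by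
      rw [AlgHom.map_adjoin]
      refine Algebra.adjoin_mono ?_
      rintro _ ⟨c, hc, rfl⟩
      exact Finset.mem_coe.mpr ((hGmem _).mpr (Or.inr (Or.inl ⟨c, Finset.mem_coe.mp hc, rfl⟩)))
    exact hmap (Subalgebra.mem_map.mpr ⟨b, hb', rfl⟩)
  have hfrac : ∀ z : K₀, ∃ a b : K, a ∈ S' ∧ b ∈ S' ∧ b ≠ 0 ∧ (z : K) = a / b := by
    intro z
    haveI := hBfr
    obtain ⟨a, b, hb, hz⟩ := IsFractionRing.div_surjective (A := B) z
    have hb0 : (b : K₀) ≠ 0 := by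
      intro h
      apply nonZeroDivisors.ne_zero hb
      exact Subtype.ext h
    refine ⟨((a : K₀) : K), ((b : K₀) : K), hBS' a a.2, hBS' b b.2,
      fun h => hb0 (by exact_mod_cast h), ?_⟩
    rw [← hz]
    push_cast
    rfl
  -- relative LU of `K₀`: a regular model `A₀ ⊇ S'` inside `K₀`
  obtain ⟨A₀, h₀, hS'A₀, hA₀fg, hA₀K₀, hreg₀⟩ :=
    exists_model_of_relLU_subfield K₀ O hLU S' (Subalgebra.fg_adjoin_finset _) hS'O hS'K₀ hfrac
  -- Lemma U at `A₀` with `u = ξ ^ p`, `q = 0`, `m = 1`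
  have huA₀ : ξ ^ p ∈ A₀ :=
    hS'A₀ (Algebra.subset_adjoin (Finset.mem_coe.mpr ((hGmem _).mpr (Or.inl rfl))))
  have hres' : ∀ b ∈ locAtCentre A₀.toSubring O, O.valuation (b ^ p - ξ ^ p) = 1 := by
    intro b hb
    have hbO : b ∈ O := locAtCentre_le h₀ hb
    have hbK₀ : b ∈ K₀ := by
      obtain ⟨y, hy, z, hz, -, rfl⟩ := mem_locAtCentre_iff.mp hb
      exact div_mem (hA₀K₀ hy) (hA₀K₀ hz)
    rw [← sub_pow_char (p := p) b ξ, map_pow, Valuation.map_sub_swap, hres b hbK₀ hbO, one_pow]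
  obtain ⟨A₁, h₁, hA₀A₁, hξA₁, hA₁fg, hA₁F, hreg₁⟩ :=
    exists_model_of_residuallyInseparablePresentation O A₀ h₀ hA₀fg hreg₀ A₀.zero_mem
      A₀.one_mem one_ne_zero huA₀
      (show ξ ^ p = (0 : K) ^ p + (1 : K) ^ p * ξ ^ p by
        rw [zero_pow hp.out.ne_zero, one_pow, zero_add, one_mul]) hres'
  have hA₁K₁ : (A₁ : Set K) ⊆ K₁ := by
    refine hA₁F.trans ?_
    exact IntermediateField.adjoin.mono k _ _ (Set.insert_subset_insert hA₀K₀)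
  -- `K₁ ⊆ Frac A₁`
  have hK₀A : ∀ A : Subalgebra k K, A₀ ≤ A → ξ ∈ A →
      K₁ ≤ IntermediateField.adjoin k (A : Set K) := by
    intro A hA₀A hξA
    refine IntermediateField.adjoin_le_iff.mpr (Set.insert_subset ?_ ?_)
    · exact IntermediateField.subset_adjoin k _ hξA
    · intro z hz
      obtain ⟨a, b, ha, hb, -, hab⟩ := hfrac ⟨z, hz⟩
      rw [show z = a / b from hab]
      exact div_mem (IntermediateField.subset_adjoin k _ (hA₀A (hS'A₀ ha)))
        (IntermediateField.subset_adjoin k _ (hA₀A (hS'A₀ hb)))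
  -- adjoin the generators `t` one at a time: `r ^ p ∈ A₀`, normality of the local ring
  have key : ∀ s : Finset K, s ⊆ t →
      ∃ (A : Subalgebra k K) (h : A.toSubring ≤ O.toSubring), A₁ ≤ A ∧ (↑s : Set K) ⊆ A ∧
        A.FG ∧ (A : Set K) ⊆ K₁ ∧ IsRegularLocalRing
          (Localization.AtPrime (Ideal.comap (Subring.inclusion h) (maximalIdeal O))) := by
    intro s
    induction s using Finset.induction_on with
    | empty => exact fun _ => ⟨A₁, h₁, le_rfl, by simp, hA₁fg, hA₁K₁, hreg₁⟩
    | insert x s hxs ih =>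
      intro hst
      obtain ⟨A, h, hA₁A, hsA, hAfg, hAK₁, hregA⟩ := ih ((Finset.subset_insert x s).trans hst)
      have hxt : x ∈ t := hst (Finset.mem_insert_self x s)
      have hxp : x ^ p ∈ A := hA₁A (hA₀A₁ (hS'A₀ (Algebra.subset_adjoin
        (Finset.mem_coe.mpr ((hGmem _).mpr (Or.inr (Or.inr ⟨x, hxt, rfl⟩)))))))
      have hxF : x ∈ IntermediateField.adjoin k (A : Set K) :=
        hK₀A A (hA₀A₁.trans hA₁A) (hA₁A hξA₁) (hSK (htS x hxt))
      obtain ⟨A', h', hAA', hxA', hA'fg, hA'F, hregA'⟩ :=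
        exists_model_adjoin_of_mem_adjoin O A h hAfg hregA hxF hp.out.ne_zero hxp
      refine ⟨A', h', hA₁A.trans hAA', ?_, hA'fg, ?_, hregA'⟩
      · rw [Finset.coe_insert]
        exact Set.insert_subset hxA' (hsA.trans hAA')
      · refine hA'F.trans ?_
        exact (IntermediateField.adjoin_le_iff.mpr (Set.insert_subset (hSK (htS x hxt)) hAK₁) :
          IntermediateField.adjoin k (insert x (A : Set K)) ≤ K₁)
  obtain ⟨A, h, -, htA, hAfg, hAK₁, hregA⟩ := key t subset_rfl
  refine ⟨A, h, ?_, hAfg, hAK₁, hregA⟩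
  rw [← ht]
  exact Algebra.adjoin_le htA

/-- **Theorem F.** Relative local uniformization ascends from `O ∩ K₀` to `O ∩ K₀(ξ)` along a
new residue `p`-th root `ξ` (`ξ ^ p ∈ K₀`, residue of `ξ` outside the residue field of
`O ∩ K₀`) — for every valuation ring `O` of `K ⊇ k` (any rank) and every ground field `k` of
characteristic `p`. [this file] -/
theorem relLocalUniformization_adjoin_of_newResidue {p : ℕ} [Fact p.Prime] [CharP K p]
    (O : ValuationSubring K) (hk : ∀ c : k, algebraMap k K c ∈ O)
    (K₀ : IntermediateField k K) (hK₀ : K₀.FG) {ξ : K} (hξp : ξ ^ p ∈ K₀)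
    (hres : ∀ c ∈ K₀, c ∈ O → O.valuation (ξ - c) = 1)
    (hLU : RelLocalUniformization k K₀ (O.comap (algebraMap K₀ K))) :
    RelLocalUniformization k ↥(IntermediateField.adjoin k (insert ξ (K₀ : Set K)))
      (O.comap (algebraMap ↥(IntermediateField.adjoin k (insert ξ (K₀ : Set K))) K)) := by
  classical
  set K₁ : IntermediateField k K := IntermediateField.adjoin k (insert ξ (K₀ : Set K)) with hK₁
  intro R hRfg _ hRO
  have hfinj : Function.Injective K₁.val := (K₁.val : K₁ →+* K).injective
  set S : Subalgebra k K := R.map K₁.val with hS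
  have hSfg : S.FG := hRfg.map _
  have hSO : S.toSubring ≤ O.toSubring := by
    rintro _ ⟨r, hr, rfl⟩
    exact hRO hr
  have hSK : (S : Set K) ⊆ K₁ := by
    rintro _ ⟨r, -, rfl⟩
    exact r.2
  obtain ⟨A, hA, hSA, hAfg, hAK, hreg⟩ :=
    exists_model_of_newResidue O hk K₀ hK₀ hξp hres hLU S hSfg hSO hSK
  obtain ⟨h₀, hreg₀⟩ := comap_model_regular K₁ O A hA hAK hreg
  have hAK' : ∀ x ∈ A, x ∈ Set.range K₁.val := fun x hx => ⟨⟨x, hAK hx⟩, rfl⟩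
  have hmap : (A.comap K₁.val).map K₁.val = A := by
    rw [Subalgebra.map_comap_eq]
    exact inf_eq_left.mpr fun x hx => hAK' x hx
  refine ⟨A.comap K₁.val, h₀, fun r hr => ?_, ?_, hreg₀⟩
  · exact (Subalgebra.mem_comap _ _ _).mpr (hSA (Subalgebra.mem_map.mpr ⟨r, hr, rfl⟩))
  · exact Subalgebra.fg_of_fg_map _ K₁.val hfinj (by rw [hmap]; exact hAfg)

end

end Summit.ResolutionOfSingularities.ResolutionOfSingularities.Theorems
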